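import Mathlib
import HarnessLib

/-!
# Route ClusUniversalCertificate — line `skew` on the crux `UniversalCertAll` (stmt-PneNP-19683): `κ ≤ codim`
(rung F-N1, cell pnp-ideate, planner p1; skeleton HOME/pnp-ideate-p1/lines/skew.lean, kept registered inside
lines/partition.lean sha16 3892e8c74b73aa85; stub 4 `stub_kappaLeCodim`, WANTED for an idle prover on STATUS 02:12Z/03:57Z)

The objects of p1's line `skew` VERBATIM (`projRank`, `skewCost`, `kappa`, `codimY`, `KappaLeCodim`; the skeleton declares them
in `Summit.PneNP.PneNP.Cruxes.UniversalCertAll.Skew`, here under the Theorems namespace `…Theorems.ClusSkew` with the same short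
names and bodies) and the registered stub

  `stub_kappaLeCodim : KappaLeCodim` — for every finite `Y ⊆ (𝔽₂^m)^n` and `y ∈ Y`, `κ_Y(y) ≤ codim_Y(y)`.

PROOF: for ANY flat `A ∋ y` inside `Y` with direction `D`, `skewCost A ≤ codim A := n·m − dim D`, because with
`r_k = rank π_k(D) ≤ m` one has `Σ_k r_k ≥ dim D` (the product of the block projections `D → Π_k π_k(D)` is injective,
`LinearMap.finrank_le_finrank_of_injective` + `Module.finrank_pi_fintype`), so `U := Σ_k (m − r_k) ≤ codim A`, and the number of
non-full blocks is `≤ U` (each contributes `≥ 1`); hence `skewCost A = #nonfull + (codim A − U) ≤ codim A`.  Taking `A` optimal for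
`codim_Y(y)` (`Nat.sInf_mem`; the singleton flat `affineSpan {y}` witnesses nonemptiness) gives `κ_Y(y) ≤ skewCost A ≤ codim_Y(y)`.

HONEST FRAMING: ONE registered M-sized stub (the easy inequality of the line `skew`; the load-bearing stub `stub_skewPays` is OPEN and
XL) of an OPEN crux of route ClusUniversalCertificate; FRONTIER rung F-N1 — nothing here bears on P vs NP.
-/

set_option linter.dupNamespace false -- `Summit.PneNP.PneNP.…`: summit = sub-problem name (D-0017 single-conjunct layout)

namespace Summit.PneNP.PneNP.Theorems.ClusSkew

open Finset

/-- Rank of the projection of the direction of the flat `A` onto block `k` (p1's `projRank`, verbatim). -/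
noncomputable def projRank {n m : ℕ} (A : AffineSubspace (ZMod 2) (Fin n → Fin m → ZMod 2)) (k : Fin n) : ℕ :=
  Module.finrank (ZMod 2)
    (A.direction.map (LinearMap.proj k : (Fin n → Fin m → ZMod 2) →ₗ[ZMod 2] (Fin m → ZMod 2)))

/-- Skew cost of a flat: `#{non-full blocks} + skewness = codim A − Σ_k (u_k − 1)⁺`, `u_k = m − projRank A k`
(p1's `skewCost`, verbatim). -/
noncomputable def skewCost (n m : ℕ) (A : AffineSubspace (ZMod 2) (Fin n → Fin m → ZMod 2)) : ℕ :=
  (Finset.univ.filter fun k : Fin n => projRank A k < m).card +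
    ((n * m - Module.finrank (ZMod 2) A.direction) - ∑ k : Fin n, (m - projRank A k))

/-- `κ_Y(y)`: the least skew cost of a flat through `y` inside `Y` (p1's `kappa`, verbatim). -/
noncomputable def kappa {n : ℕ} (m : ℕ) (Y : Finset (Fin n → Fin m → ZMod 2)) (y : Fin n → Fin m → ZMod 2) : ℕ :=
  sInf {c : ℕ | ∃ A : AffineSubspace (ZMod 2) (Fin n → Fin m → ZMod 2), y ∈ A ∧ (∀ z ∈ A, z ∈ Y) ∧ skewCost n m A = c}

/-- The crux's certificate codimension of `y` in `Y` (verbatim from the route file / p1's `codimY`). -/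
noncomputable def codimY {n : ℕ} (m : ℕ) (Y : Finset (Fin n → Fin m → ZMod 2)) (y : Fin n → Fin m → ZMod 2) : ℕ :=
  sInf {c : ℕ | ∃ A : AffineSubspace (ZMod 2) (Fin n → Fin m → ZMod 2), y ∈ A ∧ (∀ z ∈ A, z ∈ Y) ∧
    n * m ≤ Module.finrank (ZMod 2) A.direction + c}

/-- `κ ≤ codim` on `Y` (p1's `KappaLeCodim`, verbatim). -/
def KappaLeCodim : Prop :=
  ∀ n m : ℕ, ∀ Y : Finset (Fin n → Fin m → ZMod 2), ∀ y ∈ Y, kappa m Y y ≤ codimY m Y y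

/-- Each block projection of a submodule has rank `≤ m`. -/
theorem projRank_le {n m : ℕ} (A : AffineSubspace (ZMod 2) (Fin n → Fin m → ZMod 2)) (k : Fin n) : projRank A k ≤ m := by
  unfold projRank
  have h := Submodule.finrank_le
    (A.direction.map (LinearMap.proj k : (Fin n → Fin m → ZMod 2) →ₗ[ZMod 2] (Fin m → ZMod 2)))
  rw [Module.finrank_fintype_fun_eq_card, Fintype.card_fin] at h
  exact h

/-- The block projections jointly embed the direction: `dim D ≤ Σ_k rank π_k(D)`. -/
theorem finrank_direction_le_sum_projRank {n m : ℕ} (A : AffineSubspace (ZMod 2) (Fin n → Fin m → ZMod 2)) :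
    Module.finrank (ZMod 2) A.direction ≤ ∑ k : Fin n, projRank A k := by
  set D := A.direction
  let φ : D →ₗ[ZMod 2] (Π k : Fin n, (D.map (LinearMap.proj k : (Fin n → Fin m → ZMod 2) →ₗ[ZMod 2] (Fin m → ZMod 2)))) :=
    LinearMap.pi fun k => (LinearMap.proj k : (Fin n → Fin m → ZMod 2) →ₗ[ZMod 2] (Fin m → ZMod 2)).submoduleMap D
  have hφ : Function.Injective φ := by
    intro x x' hxx'
    apply Subtype.ext
    funext k
    have hk := congrArg (fun f => ((f k : D.map (LinearMap.proj k : (Fin n → Fin m → ZMod 2) →ₗ[ZMod 2]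
      (Fin m → ZMod 2))) : Fin m → ZMod 2)) hxx'
    simpa [φ] using hk
  have h := LinearMap.finrank_le_finrank_of_injective hφ
  rw [Module.finrank_pi_fintype] at h
  exact h

/-- **The skew cost of a flat is at most its codimension.** -/
theorem skewCost_le_codim (n m : ℕ) (A : AffineSubspace (ZMod 2) (Fin n → Fin m → ZMod 2)) :
    skewCost n m A ≤ n * m - Module.finrank (ZMod 2) A.direction := by
  unfold skewCost
  have hr : ∀ k : Fin n, projRank A k ≤ m := projRank_le A
  have hD := finrank_direction_le_sum_projRank A
  -- `U + Σ r_k = n m`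
  have hU : ∑ k : Fin n, (m - projRank A k) + ∑ k : Fin n, projRank A k = n * m := by
    rw [← Finset.sum_add_distrib, Finset.sum_congr rfl fun k _ => Nat.sub_add_cancel (hr k), Finset.sum_const,
      Finset.card_univ, Fintype.card_fin, smul_eq_mul]
  -- each non-full block contributes at least one to `U`
  have hN : (Finset.univ.filter fun k : Fin n => projRank A k < m).card ≤ ∑ k : Fin n, (m - projRank A k) := by
    rw [Finset.card_eq_sum_ones]
    calc ∑ k ∈ Finset.univ.filter (fun k : Fin n => projRank A k < m), 1
        ≤ ∑ k ∈ Finset.univ.filter (fun k : Fin n => projRank A k < m), (m - projRank A k) :=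
          Finset.sum_le_sum fun k hk => by
            have := (Finset.mem_filter.mp hk).2
            omega
      _ ≤ ∑ k : Fin n, (m - projRank A k) := Finset.sum_le_sum_of_subset (Finset.filter_subset _ _)
  omega

/-- **Registered stub `stub_kappaLeCodim`** of the line `skew` (stmt-PneNP-19683): `κ_Y(y) ≤ codim_Y(y)` for `y ∈ Y`, BY NAME. -/
theorem stub_kappaLeCodim : KappaLeCodim := by
  intro n m Y y hy
  -- the codimension infimum is attained (the singleton flat `{y}` witnesses nonemptiness)
  have hne : {c : ℕ | ∃ A : AffineSubspace (ZMod 2) (Fin n → Fin m → ZMod 2), y ∈ A ∧ (∀ z ∈ A, z ∈ Y) ∧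
      n * m ≤ Module.finrank (ZMod 2) A.direction + c}.Nonempty := by
    refine ⟨n * m, affineSpan (ZMod 2) {y}, mem_affineSpan (ZMod 2) (Set.mem_singleton y), ?_, ?_⟩
    · intro z hz
      rw [AffineSubspace.mem_affineSpan_singleton] at hz
      rw [hz]; exact hy
    · exact Nat.le_add_left _ _
  obtain ⟨A, hyA, hAY, hc⟩ := Nat.sInf_mem hne
  -- `κ ≤ skewCost A ≤ codim A ≤ codimY`
  have hκ : kappa m Y y ≤ skewCost n m A := Nat.sInf_le ⟨A, hyA, hAY, rfl⟩
  have hcd : n * m - Module.finrank (ZMod 2) A.direction ≤ codimY m Y y := by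
    unfold codimY
    omega
  exact hκ.trans ((skewCost_le_codim n m A).trans hcd)

end Summit.PneNP.PneNP.Theorems.ClusSkew
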